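import Summits.ResolutionOfSingularities.ResolutionOfSingularities.Theorems.PAlterationPialtFrobenius
import Summits.ResolutionOfSingularities.ResolutionOfSingularities.Theorems.PAlterationPialtRadicialCoverKit
import Summits.ResolutionOfSingularities.ResolutionOfSingularities.Theorems.PAlterationPicoverTowerTransport
import Literature.AlgebraicGeometry.Resolution.NormalizationInNormal
import Literature.AlgebraicGeometry.Resolution.ResolutionGlue
import HarnessLib

/-!
# Crux `PalterationThesis` (stmt-ResolutionOfSingularities-0552), line `Sketch` (rev. c2):
# stub `stub_core` — the twisted presentation `Core_K`

Over a PERFECT field `K` of characteristic `p`, granted the resolution of every normal variety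
`X` which is the quotient of a REGULAR variety `W` by a finite radicial dominant `h : W → X` of
EXPONENT ONE (`K(W)^p ⊆ K(X)`) and degree `p^m`, `m ≤ M` (hypothesis `hEOQ`): for `B` regular
integral separated of finite type over `K`, a finite extension `E/K(B)` and a ring map
`β : E → K(B)` with `β ∘ (K(B) → E) = Frobenius` and `[K(B) : β(E)] ≤ p^M`, the normalisation
`N := B^E` has a resolution.

**Proof (twisted presentation).** Let `F := F_B` be the absolute Frobenius of `B` (the `p`-th
power endomorphism `powEndo B p`; FINITE since `K` is perfect, universally injective, the identity
on points) and `T := B^{(F)}` the normalisation of `B` in `K(B)` viewed as an extension of `K(B)`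
through `F^♯ = (·)^p`. Since `B` is regular, hence normal, the comparison `T → B` is an
isomorphism (`exists_isIso_comparison_of_normal`), so `T` is regular. The `K(B)`-algebra map
`K(N) = E → (K(B), F^♯)` given by `β` yields, by the universal property of `N = B^E`
(`exists_hom_normalizationIn_of_algHom`), a `B`-morphism `δ : T → N`; from `δ ≫ ι_E = ι_F` it is
finite and universally injective, and reading `δ^♯` through `K(T) ≅ (K(B), F^♯)` every `z ∈ K(T)`
has `z^p ∈ K(N)` (exponent one). Degrees: `[K(T) : K(B)] = [K(T) : K(N)] · [K(N) : K(B)]`,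
`[K(N) : K(B)] = [E : K(B)]`, and
`[K(T) : K(B)] = [(K(B), F^♯) : K(B)] = [E : K(B)] · [K(B) : β(E)]` (tower `K(B) → E →β K(B)`),
so `[K(T) : K(N)] = [K(B) : β(E)] = p^m ≤ p^M`; apply `hEOQ m`.
-/

set_option linter.dupNamespace false -- mandated namespace of this single-conjunct summit

noncomputable section

open CategoryTheory AlgebraicGeometry TopologicalSpace
open Literature.AlgebraicGeometry.Resolution Literature.AlgebraicGeometry.Motives

namespace Summit.ResolutionOfSingularities.ResolutionOfSingularities.Theorems.PalterationThesis.PerfectQuotient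

/-! ## Field-theoretic degree bookkeeping -/

/-- **Tower through a "Frobenius-type" factorisation.** Let `E/K` be finite, `β : E → K` a ring
map and `L` a `K`-algebra with a ring isomorphism `e : K ≃ L` such that the structure map
`K → L` is `e ∘ β ∘ (K → E)`. Then `[L : K] = [E : K] · [K : β(E)]` (tower law for
`K → E → L`, and `L/E ≅ K/β(E)` along `e⁻¹`, `β`). [folklore] -/
theorem finrank_eq_mul_finrank_fieldRange {K E L : Type*} [Field K] [Field E] [Field L]
    [Algebra K E] [Algebra K L] (β : E →+* K) (e : K ≃+* L)
    (h : ∀ b : K, algebraMap K L b = e (β (algebraMap K E b))) :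
    Module.finrank K L = Module.finrank K E * Module.finrank β.fieldRange K := by
  letI : Algebra E L := (e.toRingHom.comp β).toAlgebra
  haveI : IsScalarTower K E L := IsScalarTower.of_algebraMap_eq fun b => h b
  rw [← Module.finrank_mul_finrank K E L]
  congr 1
  refine Algebra.finrank_eq_of_equiv_equiv β.rangeRestrictFieldEquiv e.symm ?_
  ext x
  change (β.rangeRestrictFieldEquiv x : K) = e.symm (e (β x))
  rw [RingEquiv.symm_apply_apply]
  rfl

/-! ## Degrees of function fields along dominant morphisms -/

/-- **Tower law along a composite of dominant morphisms**: for `k = g ≫ h` with `g : X → Y`,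
`h : Y → Z` dominant between integral schemes, `[K(X) : K(Z)] = [K(Y) : K(Z)] · [K(X) : K(Y)]`
(`k^♯ = g^♯ ∘ h^♯`). [folklore] -/
theorem finrank_functionFieldOver_eq_mul {X Y Z : Scheme.{0}} [IsIntegral X] [IsIntegral Y]
    [IsIntegral Z] (g : X ⟶ Y) [IsDominant g] (h : Y ⟶ Z) [IsDominant h] (k : X ⟶ Z)
    [IsDominant k] (hk : k = g ≫ h) :
    Module.finrank Z.functionField (FunctionFieldOver k) =
      Module.finrank Z.functionField (FunctionFieldOver h) *
        Module.finrank Y.functionField (FunctionFieldOver g) := by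
  letI : Algebra (FunctionFieldOver h) (FunctionFieldOver k) :=
    ((FunctionFieldOver.of k).toRingHom.comp ((RatFn.functionFieldMap g).comp
      (FunctionFieldOver.of h).symm.toRingHom)).toAlgebra
  haveI : IsScalarTower Z.functionField (FunctionFieldOver h) (FunctionFieldOver k) :=
    IsScalarTower.of_algebraMap_eq fun z =>
      RingHom.congr_fun (Picover.OfNormalizationIn.functionFieldMap_eq_comp_of_eq h g k hk) z
  rw [← Module.finrank_mul_finrank Z.functionField (FunctionFieldOver h) (FunctionFieldOver k)]
  -- the second factors agree definitionally (`FunctionFieldOver _` unfolds to `K(X)`, `K(Y)`)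
  congr 1

/-- **`[K(N) : K(X)] = [L : K(X)]` when `K(N) ≅ L` over `K(X)`**: for `h : N → X` dominant and a
ring isomorphism `e : K(N) ≃ L` with `e ∘ h^♯ = (K(X) → L)`. [folklore] -/
theorem finrank_functionFieldOver_eq_of_ringEquiv {N X : Scheme.{0}} [IsIntegral N]
    [IsIntegral X] (h : N ⟶ X) [IsDominant h] {L : Type*} [Field L] [Algebra X.functionField L]
    (e : N.functionField ≃+* L)
    (he : e.toRingHom.comp (RatFn.functionFieldMap h) = algebraMap X.functionField L) :
    Module.finrank X.functionField (FunctionFieldOver h) = Module.finrank X.functionField L := by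
  refine Algebra.finrank_eq_of_equiv_equiv (RingEquiv.refl _)
    ((FunctionFieldOver.of h).symm.trans e) ?_
  rw [← he]
  ext x
  rfl

/-- **Exponent one, read through a twist.** Let `δ ≫ ι = ιF` be dominant morphisms of integral
schemes `T → N → B`, `eT : K(T) ≃ L` with `eT ∘ ιF^♯ = (K(B) → L)`, and suppose the structure
map of `L` is `b ↦ eL (b ^ n)` for a ring isomorphism `eL : K(B) ≃ L`. Then every `z ∈ K(T)` has
`z ^ n ∈ δ^♯(K(N))`: with `w := eL⁻¹ (eT z)`, `z ^ n = ιF^♯(w) = δ^♯(ι^♯(w))`. [folklore] -/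
theorem pow_mem_range_algebraMap_of_twist {B N T : Scheme.{0}} [IsIntegral B] [IsIntegral N]
    [IsIntegral T] (ι : N ⟶ B) [IsDominant ι] (δ : T ⟶ N) [IsDominant δ] (ιF : T ⟶ B)
    [IsDominant ιF] (hδι : δ ≫ ι = ιF) {L : Type*} [Field L] [Algebra B.functionField L]
    (eT : T.functionField ≃+* L)
    (heT : eT.toRingHom.comp (RatFn.functionFieldMap ιF) = algebraMap B.functionField L)
    (eL : B.functionField ≃+* L) (n : ℕ)
    (halg : ∀ b : B.functionField, algebraMap B.functionField L b = eL (b ^ n)) :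
    ∀ z : FunctionFieldOver δ,
      z ^ n ∈ (algebraMap N.functionField (FunctionFieldOver δ)).range := by
  intro z
  have hc := Picover.OfNormalizationIn.functionFieldMap_eq_comp_of_eq ι δ ιF hδι.symm
  set w : B.functionField := eL.symm (eT ((FunctionFieldOver.of δ).symm z)) with hw
  refine ⟨RatFn.functionFieldMap ι w, ?_⟩
  have key : RatFn.functionFieldMap ιF w = (FunctionFieldOver.of δ).symm z ^ n := by
    apply eT.injective
    have h1 := RingHom.congr_fun heT w
    simp only [RingEquiv.toRingHom_eq_coe, RingHom.coe_comp, RingHom.coe_coe,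
      Function.comp_apply] at h1
    rw [map_pow, h1, halg, hw, map_pow, RingEquiv.apply_symm_apply]
  rw [FunctionFieldOver.algebraMap_apply]
  change FunctionFieldOver.of δ (((RatFn.functionFieldMap δ).comp (RatFn.functionFieldMap ι)) w) =
    z ^ n
  rw [← hc, key, map_pow, RingEquiv.apply_symm_apply]

/-- **Domination by a normalisation from a ring map of function fields**: for `ι : N → B`
integral dominant between integral schemes, `L` an extension of `K(B)` and a ring map
`τ : K(N) → L` with `τ ∘ ι^♯ = (K(B) → L)`, there is an integral dominant `δ : B^L → N` with
`δ ≫ ι = (B^L → B)` (`Pialt.RadiciallyRegular.exists_hom_normalizationIn_of_algHom` for the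
`K(B)`-algebra map `τ`). [folklore] -/
theorem exists_hom_normalizationIn_of_ringHom (B : Scheme.{0}) [IsIntegral B] {N : Scheme.{0}}
    [IsIntegral N] (ι : N ⟶ B) [IsIntegralHom ι] [IsDominant ι] (L : Type) [Field L]
    [Algebra B.functionField L] (τ : N.functionField →+* L)
    (hτ : τ.comp (RatFn.functionFieldMap ι) = algebraMap B.functionField L) :
    ∃ δ : normalizationIn B L ⟶ N,
      δ ≫ ι = normalizationInι B L ∧ IsIntegralHom δ ∧ IsDominant δ :=
  Pialt.RadiciallyRegular.exists_hom_normalizationIn_of_algHom B L ι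
    { τ.comp (FunctionFieldOver.of ι).symm.toRingHom with
      commutes' := fun b => RingHom.congr_fun hτ b }

/-! ## The stub -/

/-- **The twisted presentation `Core_K`** (stub `stub_core` of the line `Sketch`, rev. c2, of the
crux `PalterationThesis`; statement verbatim from the ledger registration). Over a perfect field
`K` of characteristic `p`, granted `ExpOneQuot_K m` for all `m ≤ M` (every normal variety which
is the quotient of a regular one by a finite radicial dominant morphism of exponent one and degree
`p^m` has a resolution): for `B` regular integral separated of finite type over `K`, a finite
extension `E/K(B)` and a ring map `β : E → K(B)` with `β ∘ (K(B) → E) = Frobenius` and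
`[K(B) : β(E)] ≤ p^M`, the normalisation `B^E` has a resolution — it is the quotient of the
regular Frobenius twist `B^{(F)} ≅ B` by a finite radicial morphism of exponent one and degree
`[K(B) : β(E)]`. [cite: Temkin2013, Rem. 1.3.5 (i)–(ii)] -/
theorem stub_core (p : ℕ) (hp : p.Prime) (K : Type) [Field K] [CharP K p] [PerfectField K] :
    ∀ M : ℕ,
      (∀ m : ℕ, m ≤ M → ∀ (X W : Scheme.{0}) [IsIntegral X] [IsIntegral W]
        (f : X ⟶ Spec (.of K)) (h : W ⟶ X) [IsDominant h],
        IsSeparated f → LocallyOfFiniteType f → QuasiCompact f →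
        (∀ x : X, IsIntegrallyClosed (X.presheaf.stalk x)) → Scheme.IsRegular W →
        IsFinite h → UniversallyInjective h →
        (∀ z : FunctionFieldOver h,
          z ^ p ∈ (algebraMap X.functionField (FunctionFieldOver h)).range) →
        Module.finrank X.functionField (FunctionFieldOver h) = p ^ m →
        Scheme.HasResolution X) →
      ∀ (B : Scheme.{0}) [IsIntegral B] (f : B ⟶ Spec (.of K)),
        IsSeparated f → LocallyOfFiniteType f → QuasiCompact f → Scheme.IsRegular B →
        ∀ (E : Type) [Field E] [Algebra B.functionField E] [FiniteDimensional B.functionField E]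
          (β : E →+* B.functionField),
          (∀ b : B.functionField, β (algebraMap B.functionField E b) = b ^ p) →
          Module.finrank β.fieldRange B.functionField ≤ p ^ M →
          Scheme.HasResolution (normalizationIn B E) := by
  intro M hEOQ B _ f hsep hlft hqc hBreg E _ _ _ β hβ hM
  haveI : Fact p.Prime := ⟨hp⟩
  haveI := hsep
  haveI := hlft
  haveI := hqc
  -- Step 0: the finite Frobenius `F = F_B` (`K` perfect), radicial, the identity on points
  have hpB : (p : Γ(B, ⊤)) = 0 := natCast_appTop_eq_zero p f
  have hadd := add_pow_sections p hpB 1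
  set F := powEndo B (p ^ 1) (pow_ne_zero 1 hp.ne_zero) hadd with hFdef
  haveI : IsFinite F := isFinite_powEndo p f 1 hadd
  haveI : UniversallyInjective F := universallyInjective_powEndo B p 1 hadd hpB
  haveI : Surjective F := ⟨fun x => ⟨x, rfl⟩⟩
  have hF : ∀ y : B.functionField, RatFn.functionFieldMap F y = y ^ p ^ 1 :=
    functionFieldMap_powEndo B (p ^ 1) _ hadd
  -- `B` is regular, hence normal
  have hBn : ∀ b : B, IsIntegrallyClosed (B.presheaf.stalk b) := fun b => by
    haveI := hBreg b
    exact isIntegrallyClosed_of_isRegularLocalRing _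
  -- Step 1: `N := B^E` is normal and finite over `B`, with `K(N) ≅ E` over `K(B)`
  haveI : IsFinite (normalizationInι B E) := isFinite_normalizationInι B E f
  have hNn : ∀ y : normalizationIn B E,
      IsIntegrallyClosed ((normalizationIn B E).presheaf.stalk y) :=
    isIntegrallyClosed_stalk_normalizationIn B E
  obtain ⟨eN, heN⟩ :=
    Picover.FunctionFieldNormalizationIn.stub_functionField_normalizationIn B E
  -- Step 2: the Frobenius twist `T := B^{(F)} ≅ B` is regular, `K(T) ≅ (K(B), F^♯)` over `K(B)`
  haveI : IsFinite (normalizationInι B (FunctionFieldOver F)) :=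
    isFinite_normalizationInι B (FunctionFieldOver F) f
  obtain ⟨φ, hφiso, hφF, -⟩ := exists_isIso_comparison_of_normal K B B f F hBn
  haveI := hφiso
  have hTreg : Scheme.IsRegular (normalizationIn B (FunctionFieldOver F)) :=
    Scheme.IsRegular.of_iso (inv φ) hBreg
  obtain ⟨eT, heT⟩ :=
    Picover.FunctionFieldNormalizationIn.stub_functionField_normalizationIn B (FunctionFieldOver F)
  -- the structure map of `(K(B), F^♯)` is `b ↦ b ^ p`
  have halg : ∀ b : B.functionField,
      algebraMap B.functionField (FunctionFieldOver F) b = FunctionFieldOver.of F (b ^ p) := by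
    intro b
    rw [FunctionFieldOver.algebraMap_apply, hF, pow_one]
  -- Step 3: `δ : T → N` over `B`, from the `K(B)`-compatible ring map `β : K(N) = E → (K(B), F^♯)`
  obtain ⟨δ, hδι, hδint, hδdom⟩ := exists_hom_normalizationIn_of_ringHom B (normalizationInι B E)
    (FunctionFieldOver F) ((FunctionFieldOver.of F).toRingHom.comp (β.comp eN.toRingHom)) (by
      ext b
      have h1 := RingHom.congr_fun heN b
      simp only [RingEquiv.toRingHom_eq_coe, RingHom.coe_comp, RingHom.coe_coe,
        Function.comp_apply] at h1 ⊢
      rw [h1, hβ, halg])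
  haveI := hδint
  haveI := hδdom
  -- Step 4: `δ` is finite and universally injective (cancellation in `δ ≫ ι_E = ι_F`)
  have hδfin : IsFinite δ := by
    have h1 : IsFinite (δ ≫ normalizationInι B E) := by
      rw [hδι]
      infer_instance
    exact IsFinite.comp_iff.mp h1
  haveI := hδfin
  haveI : UniversallyInjective (normalizationInι B (FunctionFieldOver F)) := by
    rw [← hφF]
    exact MorphismProperty.comp_mem _ _ _ (inferInstanceAs (UniversallyInjective φ))
      (inferInstanceAs (UniversallyInjective F))
  have hδui : UniversallyInjective δ := by
    haveI : UniversallyInjective (δ ≫ normalizationInι B E) := by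
      rw [hδι]
      infer_instance
    exact universallyInjective_of_comp δ (normalizationInι B E)
  -- Step 5: exponent one, `K(T)^p ⊆ δ^♯ K(N)`
  have hexp : ∀ z : FunctionFieldOver δ,
      z ^ p ∈ (algebraMap (normalizationIn B E).functionField (FunctionFieldOver δ)).range :=
    pow_mem_range_algebraMap_of_twist (normalizationInι B E) δ
      (normalizationInι B (FunctionFieldOver F)) hδι eT heT (FunctionFieldOver.of F) p halg
  -- Step 6: the degree `[K(T) : K(N)] = [K(B) : β(E)]` is `p ^ m` with `m ≤ M`
  haveI : IsPurelyInseparable (normalizationIn B E).functionField (FunctionFieldOver δ) :=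
    Picover.FunctionFieldRadicial.stub_functionFieldRadicial _ _ δ
  haveI : CharP (normalizationIn B E).functionField p :=
    Picover.TowerTransport.charP_functionField (normalizationIn B E) (normalizationInι B E ≫ f)
  haveI : ExpChar (normalizationIn B E).functionField p := ExpChar.prime hp
  obtain ⟨m, hm⟩ := IsPurelyInseparable.finrank_eq_pow (normalizationIn B E).functionField
    (FunctionFieldOver δ) p
  have h1 := finrank_functionFieldOver_eq_mul δ (normalizationInι B E)
    (normalizationInι B (FunctionFieldOver F)) hδι.symm
  have h2 := finrank_functionFieldOver_eq_of_ringEquiv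
    (normalizationInι B (FunctionFieldOver F)) eT heT
  have h3 := finrank_functionFieldOver_eq_of_ringEquiv (normalizationInι B E) eN heN
  have h4 : Module.finrank B.functionField (FunctionFieldOver F) =
      Module.finrank B.functionField E * Module.finrank β.fieldRange B.functionField :=
    finrank_eq_mul_finrank_fieldRange β (FunctionFieldOver.of F) fun b => by rw [halg, hβ]
  have hdeg : Module.finrank (normalizationIn B E).functionField (FunctionFieldOver δ) =
      Module.finrank β.fieldRange B.functionField := by
    apply Nat.eq_of_mul_eq_mul_left (Module.finrank_pos (R := B.functionField) (M := E))
    rw [← h4, ← h2, h1, h3]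
  have hmM : m ≤ M :=
    (Nat.pow_le_pow_iff_right hp.one_lt).mp (by rw [← hm, hdeg]; exact hM)
  -- Step 7: `N` is an exponent-one quotient of degree `p ^ m` of the regular `T`
  exact hEOQ m hmM (normalizationIn B E) (normalizationIn B (FunctionFieldOver F))
    (normalizationInι B E ≫ f) δ inferInstance inferInstance inferInstance hNn hTreg hδfin hδui
    hexp hm

end Summit.ResolutionOfSingularities.ResolutionOfSingularities.Theorems.PalterationThesis.PerfectQuotient

end
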